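import Summits.QuantumFields.YangMills.Theorems.GrossTransferStubLinTestPointwisePackage
import HarnessLib

/-!
# LINE 28 «GrossTransfer» (crux stmt-QuantumFields-23083 `RevelationMartingale.MeanDeviationL`; parent crux `UnitScaleTilt.HistoryTailL` stmt-QuantumFields-19936),
# skeleton v3.3 — THE REGISTRY ROW `stub_linTest` CLOSED BY NAME

Cell `ym3-torus` (YM ladder rung R3 = continuum SU(2) Yang–Mills on the three-torus — a RUNG, NOT the Clay problem: not d = 4, not infinite volume,
not a mass gap); width seat `ym-ust-19936-w2` (gen 16; lineage pen of the stub, author-designate of the closing one-liner per ★★OWNER WORD 65).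
This definition-free file states the registered row `stub_linTest` of `Summits/QuantumFields/YangMills/Cruxes/HistoryTailL/Lines/gross_transfer.lean`
(v3.3, :95) with its SIGNATURE VERBATIM and proves it BY NAME: ✓KNIT-E1′ `GrossTransferStubLinTestOfPointwise.stub_linTest_of_pointwisePackage'` (p747470:
the integrated stub from the pointwise package, via ✓INT-COLLAR) applied to ✓KNIT-E2 `GrossTransferStubLinTestPointwisePackage.pointwisePackage`
(the pointwise package: P-LOC linearisation on the dressing box, the smoothly cut-off free Coulomb potential `χ·δ₂(G₀∗w)` carried by the three
Schwinger–Dyson test fields, the Bianchi and collar rows, the squares and the windows `N·j ≤ K`).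
HONEST SCOPE.  A one-line composition; the content is in the two imported files and their suppliers across the cell.  `stub_linTest` alone does NOT
close 23083 (`stub_meanDeviationDeep` = stmt-QuantumFields-23134 stays open); nothing of 23134, `HistoryTailL` (19936) or the rung R3 is proved.
R3 = continuum SU(2) Yang–Mills on the three-torus — NOT d = 4, NOT infinite volume, NOT a mass gap, NOT the Clay problem; the Yang–Mills mass
gap is NOT proved.
References: L. Gross, Commun. Math. Phys. 92 (1983) 137–162, Thm 2.2 [GrossCMP1983]; T. Bałaban, Commun. Math. Phys. 98 (1985) 17–51,
(0.4)∕(19) [Balaban1985Averaging].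
-/

set_option autoImplicit false

noncomputable section

namespace Summit.QuantumFields.YangMills.Theorems.GrossTransferStubLinTest

open MeasureTheory
open scoped BigOperators Matrix.Norms.Frobenius
open Literature.MathematicalPhysics.QuantumFieldTheory.Balaban1983to89
open Literature.MathematicalPhysics.QuantumFieldTheory.Balaban1983to89.T3ContinuumYM3Torus
open Literature.MathematicalPhysics.QuantumFieldTheory.Balaban1983to89.T3UnitScaleTilt
open Literature.MathematicalPhysics.QuantumFieldTheory.Balaban1983to89.T3UnitLawDensityEML (ℰp)
open Literature.MathematicalPhysics.QuantumFieldTheory.Balaban1983to89.T4AxialGaugeSmallField (axialGauge boxPlaqs boxBonds castSite)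
open Literature.MathematicalPhysics.QuantumFieldTheory.Balaban1983to89.B7Prop1Explicit (e)
open Literature.MathematicalPhysics.QuantumFieldTheory.Balaban1983to89.B8Lemma1NonAbelian (lowPart)
open Literature.MathematicalPhysics.QuantumLattice (fundamentalRep)
open Summit.QuantumFields.YangMills.Theorems.UnitScaleGibbsActionDerivativeSlotCalculus (actionDeriv actionDeriv₂ slotBond)

/-- ★★★ **`stub_linTest` — DETERMINISTIC LINEARISATION READ ON THE TREE-GAUGE-DRESSED FIELD, INTEGRATED** (registered text of skeleton v3.3 :95, verbatim):
for every block size `L` there are `C, c, N, γ₁` such that for every family with `F.L = L`, `0 < γ ≤ γ₁`, `1 ≤ j`, `N·j ≤ K` and every reference plaquette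
`a = ⟨x; 1, 2⟩` of level `j`, a non-wrapping box, three `𝔰𝔲(2)` test fields and collar weights with rows R1–R7 exist such that
`∫ dist₁(Ū^j(∂a))² ≤ C·Σ_α ∫ Y_α² + Σ_b ω_b ∫ dist₁((VU) b)² + C·γL^{−(K−j)} + 4·μ_K{¬ all box plaquettes θ_K-small}`.
BY NAME: `stub_linTest_of_pointwisePackage' pointwisePackage`. [cite: GrossCMP1983, Thm 2.2 p.143; Balaban1985Averaging, (19) p.21] -/
theorem stub_linTest :
    ∀ (L : ℕ), ∃ (C : ℝ) (c N : ℕ), 0 ≤ C ∧ 0 < N ∧ ∃ γ₁ : ℝ, 0 < γ₁ ∧ γ₁ ≤ 1 ∧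
        ∀ (F : T3Family) (γ : ℝ), F.L = L → 0 < γ → γ ≤ γ₁ → ∀ (K j : ℕ), 1 ≤ j → N * j ≤ K →
          ∀ a : Plaq (F.P K) j, a.μ.val = 1 → a.ν.val = 2 →
            ∃ (lo hi : Fin (F.P K).d → ℤ) (n : ℕ) (u : Fin 3 → PBond (F.P K) 0 → Matrix (Fin 2) (Fin 2) ℂ)
              (ω : PBond (F.P K) 0 → ℝ),
              (∀ κ, lo κ ≤ hi κ ∧ hi κ ≤ lo κ + n) ∧ 2 * n + 6 ≤ (F.P K).sitesPerDir 0 ∧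
              (∀ α b, star (u α b) = -(u α b) ∧ (u α b).trace = 0) ∧
              (∀ α b, u α b ≠ 0 → ∃ x : Fin (F.P K).d → ℤ,
                  lo + 1 ≤ x ∧ x + e b.dir + 1 ≤ hi ∧ b.src = castSite x ∧ lowPart b.dir (x - lo) ≠ 0) ∧
              (n : ℝ) ≤ C * (L : ℝ) ^ (c * j) ∧
              (∀ α, ∑ p : Plaq (F.P K) 0, ‖u α (slotBond p 0) + u α (slotBond p 1) - u α (slotBond p 2) - u α (slotBond p 3)‖ ^ 2 ≤ C * (L : ℝ) ^ j) ∧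
              (∀ α, ∑ b : PBond (F.P K) 0, ‖u α b‖ ^ 2 ≤ C * (L : ℝ) ^ (c * j)) ∧
              (∀ b, 0 ≤ ω b) ∧ (∀ b, ω b ≠ 0 → b ∈ (boxBonds lo hi : Set (PBond (F.P K) 0))) ∧
              (n : ℝ) * ∑ b : PBond (F.P K) 0, ω b ≤ C * (L : ℝ) ^ j ∧
              ∫ U, (GaugeGroup.dist1 (GaugeField.plaqHol
                  (Averaging.iter (fun i' => BlockAveraging.blockAvg (P := F.P K) (j := i') ℰp) j U) a)) ^ 2 ∂(gibbsK F ℰp γ K)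
                ≤ C * ∑ α, ∫ U, (actionDeriv (fundamentalRep (Fin 2)) (u α) (GaugeField.gaugeAct (axialGauge U lo hi) U)) ^ 2 ∂(gibbsK F ℰp γ K)
                  + ∑ b : PBond (F.P K) 0, ω b *
                      ∫ U, (GaugeGroup.dist1 (GaugeField.gaugeAct (axialGauge U lo hi) U b)) ^ 2 ∂(gibbsK F ℰp γ K)
                  + C * (γ * ((L : ℝ)⁻¹) ^ (K - j))
                  + 4 * (gibbsK F ℰp γ K).real {U | ¬ PlaqSmallOn (boxPlaqs lo hi) ((γ * ((L : ℝ)⁻¹) ^ K) ^ ((3 : ℝ) / 8)) U} :=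
  GrossTransferStubLinTestOfPointwise.stub_linTest_of_pointwisePackage' GrossTransferStubLinTestPointwisePackage.pointwisePackage

end Summit.QuantumFields.YangMills.Theorems.GrossTransferStubLinTest

end
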